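import Mathlib
import HarnessLib.Audit
import Summits.PneNP.PneNP.Theorems.PstarHalfFreeGate
import Summits.PneNP.PneNP.Theorems.PstarTipsChain

/-!
# Pure connectors: witness normal form, (T3)-transfer to `K ∖ d`, and the minimal-core reduction (ROUND-24, O1; memo g26 §58)

FRONTIER range-avoidance ladder, rung F-N3, ROUND 24 (cell `pnp-ideate`, prover-2 memo `g26/O1-LOCALITY-g26.md` §58; typed targets
`PstarCoreBoundTargets.TerminalFive` / `TerminalPeelable` (p646951); census node `PstarMenuCriterion.MenuCriterionBound`; restricted-model proof
complexity — nothing here bears on `P` versus `NP`).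

The planner's exact-menu census (p3 memo `r24/CORE-BOUND-NOTES.md` §14.65–14.67) singles out PURE CONNECTORS: a dirty chord `d` of the terminal
core `(K; Γ₁, Γ₂)` whose AND pair `(p, q)` is private to `d`, with `q` untouched by the readers and `p` touched by exactly one menu monomial, the
gate `h = (s, p) ∈ G₂ ∖ G₁` (one reader; the other channel placements reduce to this one by `PstarChordReadOutsideKill.terminal_sum`), and
`p, q` not read linearly.  This file records what (T3) + (M0) say about such a member, for all core sizes:

* `false_of_naked` — a member whose two private AND variables are touched by nothing cannot exist; `partner_false_at_witness` — if `q` is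
  untouched, every (M0) witness of `d` has `x_p = 0`; `gate_witness` — for a pure connector moreover `x_s = 1` (the gate is armed and off);
* **`transfer`** — (T3) TRANSFERS to the smaller family: on `Sol(K ∖ d) ∩ {Γ₁ = b₁}` the MODIFIED reader `Γ₂' = Γ₂[h ↦ s] = (C₂ ∆ {s}, G₂ ∖ h, b₂)`
  (the gate replaced by its literal, i.e. `p := 1`) misses `b₂`; and where the XOR part of `d` is on target, `x_s = 0` (`literal_false_of_xor`);
* **`exists_core`** — hence, when `Γ₁ ∧ Γ₂'` is satisfiable at all, `K ∖ d` contains a MINIMAL CORE `M` for the pair `(Γ₁, Γ₂')`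
  (`PstarUnionCovers.TerminalNC`: (T3) + (M0), not necessarily XOR-closed), whose XOR core is empty or a TERMINAL core for a peeled pair
  (`PstarTipsChain.core_terminal`) — so inside the core-bound induction `#xcore M ≤ 5` (`card_xcore_core_le_five`);
* `witness_outside_core` — and every member `f ∉ M ∪ {d}` of `K` has ALL its (M0) witnesses with `x_s = 1`, `x_p = 0`.

Reading for the census (memo §58): a pure connector plants a (≤ 5)-member terminal sub-core (or an empty-core coincidence) for the channel
pair `(Γ₁, Γ₂[h ↦ s])` inside `K ∖ d`, and pins `s = 1` at the witnesses of everything outside it.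
-/

set_option linter.dupNamespace false -- `Summit.PneNP.PneNP.…`: summit = sub-problem name (D-0017 single-conjunct layout)

open Finset Literature.Computability.Complexity
open scoped symmDiff
open Summit.PneNP.PneNP.Theorems.PstarFibrePolys (bit bit_injective)
open Summit.PneNP.PneNP.Theorems.PstarTyped (Typed)
open Summit.PneNP.PneNP.Theorems.PstarSALevel (varSet bdry BoundaryExpanding SimpleOverlap)
open Summit.PneNP.PneNP.Theorems.PstarGapPeeling (eval_pure eval_update_of_not_mem)
open Summit.PneNP.PneNP.Theorems.PstarGapOneAll (gval)
open Summit.PneNP.PneNP.Theorems.PstarGConstraint (bit_gval gval_update_of_forall_ne)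
open Summit.PneNP.PneNP.Theorems.PstarGraphQuadGapTwoForms (sum_symmDiff_zmod2)
open Summit.PneNP.PneNP.Theorems.PstarCoreBound (XorClosed)
open Summit.PneNP.PneNP.Theorems.PstarCoreBoundTargets (Terminal)
open Summit.PneNP.PneNP.Theorems.PstarChordReadSwitch (solves_update_of_outside)
open Summit.PneNP.PneNP.Theorems.PstarHalfFreeGate (gval_flip_halfFree)
open Summit.PneNP.PneNP.Theorems.PstarUnion (SatPair)
open Summit.PneNP.PneNP.Theorems.PstarUnionCovers (TerminalNC exists_minimal_core satPair_mono)
open Summit.PneNP.PneNP.Theorems.PstarTipsPeel (xcore xcore_subset)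
open Summit.PneNP.PneNP.Theorems.PstarTipsChain (core_terminal)

namespace Summit.PneNP.PneNP.Theorems.PstarPureConnector

variable {n m : ℕ} {I : LocalMap 4 n m} {r : ℕ} {y : Fin m → Bool} {K : Finset (Fin m)} {w₁ w₂ : Finset (Fin n) × Finset (Fin m) × Bool}
  {d h : Fin m} {p q s : Fin n}

/-! ## Setting a private AND pair -/
section Private

/-- The member `d` with AND pair `{p, q}` evaluates to `x_{v₀} ⊕ x_{v₁} ⊕ x_p·x_q`. -/
theorem eval_eq (hI : I.IsPure xorAndPred) (hpq : (I.vars d 2 = p ∧ I.vars d 3 = q) ∨ (I.vars d 2 = q ∧ I.vars d 3 = p)) (x : Fin n → Bool) :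
    I.eval x d = xor (xor (x (I.vars d 0)) (x (I.vars d 1))) (x p && x q) := by
  rw [eval_pure I hI x d]
  rcases hpq with ⟨h2, h3⟩ | ⟨h2, h3⟩
  · rw [h2, h3]
  · rw [h2, h3, Bool.and_comm]

/-- The two AND variables of an output are distinct (pure instance). -/
theorem ne_of_slots (hI : I.IsPure xorAndPred) (hpq : (I.vars d 2 = p ∧ I.vars d 3 = q) ∨ (I.vars d 2 = q ∧ I.vars d 3 = p)) : p ≠ q := by
  have h23 : I.vars d 2 ≠ I.vars d 3 := fun e => absurd (hI.2 d e) (by decide)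
  rcases hpq with ⟨h2, h3⟩ | ⟨h2, h3⟩
  · rw [← h2, ← h3]; exact h23
  · rw [← h2, ← h3]; exact h23.symm

/-- **Setting the private pair.**  If `p, q` are AND variables of `d` occurring in no other member of `K`, then from any point satisfying `K ∖ d`
the point with `x_p := a`, `x_q := c` satisfies `K ∖ d`, and satisfies `d` iff `x_{v₀} ⊕ x_{v₁} ⊕ a·c = y_d`. -/
theorem solves_set_pair (hI : I.IsPure xorAndPred) (hT : Typed I)
    (hpq : (I.vars d 2 = p ∧ I.vars d 3 = q) ∨ (I.vars d 2 = q ∧ I.vars d 3 = p))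
    (hpK : ∀ j ∈ K, j ≠ d → p ∉ varSet I j) (hqK : ∀ j ∈ K, j ≠ d → q ∉ varSet I j)
    {x : Fin n → Bool} (hx : ∀ j ∈ K.erase d, I.eval x j = y j) (a c : Bool) :
    (∀ j ∈ K.erase d, I.eval (Function.update (Function.update x p a) q c) j = y j) ∧
      (I.eval (Function.update (Function.update x p a) q c) d = xor (xor (x (I.vars d 0)) (x (I.vars d 1))) (a && c)) := by
  have hpq' : p ≠ q := ne_of_slots hI hpq
  -- the XOR slots of `d` are neither `p` nor `q` (typed)
  have hv : ∀ t : Fin 4, t.val < 2 → I.vars d t ≠ p ∧ I.vars d t ≠ q := fun t ht => by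
    rcases hpq with ⟨h2, h3⟩ | ⟨h2, h3⟩
    · exact ⟨fun e => hT d d t 2 ht (by decide) (e.trans h2.symm), fun e => hT d d t 3 ht (by decide) (e.trans h3.symm)⟩
    · exact ⟨fun e => hT d d t 3 ht (by decide) (e.trans h3.symm), fun e => hT d d t 2 ht (by decide) (e.trans h2.symm)⟩
  refine ⟨fun j hj => ?_, ?_⟩
  · obtain ⟨hjd, hjK⟩ := mem_erase.1 hj
    rw [eval_update_of_not_mem I j _ (hqK j hjK hjd), eval_update_of_not_mem I j _ (hpK j hjK hjd)]
    exact hx j hj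
  · rw [eval_eq hI hpq]
    have e0 : Function.update (Function.update x p a) q c (I.vars d 0) = x (I.vars d 0) := by
      rw [Function.update_of_ne (hv 0 (by decide)).2, Function.update_of_ne (hv 0 (by decide)).1]
    have e1 : Function.update (Function.update x p a) q c (I.vars d 1) = x (I.vars d 1) := by
      rw [Function.update_of_ne (hv 1 (by decide)).2, Function.update_of_ne (hv 1 (by decide)).1]
    rw [e0, e1, Function.update_self, Function.update_of_ne hpq', Function.update_self]

/-- A G-constraint not reading `p, q` (not in `C`, in no monomial) does not see the update. -/
theorem gval_set_pair {C : Finset (Fin n)} {G : Finset (Fin m)} (hpC : p ∉ C) (hqC : q ∉ C)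
    (hpG : ∀ g ∈ G, I.vars g 2 ≠ p ∧ I.vars g 3 ≠ p) (hqG : ∀ g ∈ G, I.vars g 2 ≠ q ∧ I.vars g 3 ≠ q) (x : Fin n → Bool) (a c : Bool) :
    gval I C G (Function.update (Function.update x p a) q c) = gval I C G x := by
  rw [gval_update_of_forall_ne I _ hqC hqG, gval_update_of_forall_ne I _ hpC hpG]

/-- **NO NAKED MEMBER.**  A member of a terminal core whose private AND pair is touched by nothing (no monomial of the readers, no linear read)
cannot exist: set the pair to satisfy it at its own (M0) witness. -/
theorem false_of_naked (hI : I.IsPure xorAndPred) (hT : Typed I) (ht : Terminal I r y K w₁ w₂) (hd : d ∈ K)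
    (hpq : (I.vars d 2 = p ∧ I.vars d 3 = q) ∨ (I.vars d 2 = q ∧ I.vars d 3 = p))
    (hpK : ∀ j ∈ K, j ≠ d → p ∉ varSet I j) (hqK : ∀ j ∈ K, j ≠ d → q ∉ varSet I j)
    (hpC : p ∉ w₁.1 ∧ p ∉ w₂.1) (hqC : q ∉ w₁.1 ∧ q ∉ w₂.1)
    (hpG : ∀ g ∈ w₁.2.1 ∪ w₂.2.1, I.vars g 2 ≠ p ∧ I.vars g 3 ≠ p) (hqG : ∀ g ∈ w₁.2.1 ∪ w₂.2.1, I.vars g 2 ≠ q ∧ I.vars g 3 ≠ q) : False := by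
  obtain ⟨-, -, -, -, -, -, hT3, hM0⟩ := ht
  obtain ⟨x, hx, hx₁, hx₂⟩ := hM0 d hd
  set c := xor (xor (x (I.vars d 0)) (x (I.vars d 1))) (y d) with hc
  obtain ⟨hK', hdval⟩ := solves_set_pair (K := K) (y := y) hI hT hpq hpK hqK hx true c
  refine hT3 ⟨Function.update (Function.update x p true) q c, fun j hj => ?_, ?_, ?_⟩
  · by_cases hjd : j = d
    · subst hjd; rw [hdval, Bool.true_and, hc]
      cases x (I.vars j 0) <;> cases x (I.vars j 1) <;> cases y j <;> decide
    · exact hK' j (mem_erase.2 ⟨hjd, hj⟩)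
  · rw [gval_set_pair hpC.1 hqC.1 (fun g hg => hpG g (mem_union_left _ hg)) (fun g hg => hqG g (mem_union_left _ hg))]; exact hx₁
  · rw [gval_set_pair hpC.2 hqC.2 (fun g hg => hpG g (mem_union_right _ hg)) (fun g hg => hqG g (mem_union_right _ hg))]; exact hx₂

/-- **UNTOUCHED PRIVATE ⇒ PARTNER OFF AT THE WITNESS.**  If the private `q` of `d` is touched by nothing, every (M0) witness of `d` has `x_p = 0`
(else flipping `x_q` alone would satisfy `d` and nothing else would move). -/
theorem partner_false_at_witness (hI : I.IsPure xorAndPred) (hT : Typed I) (ht : Terminal I r y K w₁ w₂)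
    (hpq : (I.vars d 2 = p ∧ I.vars d 3 = q) ∨ (I.vars d 2 = q ∧ I.vars d 3 = p)) (hqK : ∀ j ∈ K, j ≠ d → q ∉ varSet I j)
    (hqC : q ∉ w₁.1 ∧ q ∉ w₂.1) (hqG : ∀ g ∈ w₁.2.1 ∪ w₂.2.1, I.vars g 2 ≠ q ∧ I.vars g 3 ≠ q)
    {x : Fin n → Bool} (hx : ∀ j ∈ K.erase d, I.eval x j = y j) (hx₁ : gval I w₁.1 w₁.2.1 x = w₁.2.2) (hx₂ : gval I w₂.1 w₂.2.1 x = w₂.2.2) :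
    x p = false := by
  obtain ⟨-, -, -, -, -, -, hT3, -⟩ := ht
  by_contra hp
  rw [Bool.not_eq_false] at hp
  have hv : ∀ t : Fin 4, t.val < 2 → I.vars d t ≠ q := fun t ht' => by
    rcases hpq with ⟨-, h3⟩ | ⟨h2, -⟩
    · exact fun e => hT d d t 3 ht' (by decide) (e.trans h3.symm)
    · exact fun e => hT d d t 2 ht' (by decide) (e.trans h2.symm)
  have hpq' : p ≠ q := ne_of_slots hI hpq
  -- `d` fails at the witness
  have hdx : I.eval x d ≠ y d := fun e => hT3 ⟨x, fun j hj => by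
    by_cases hjd : j = d
    · rw [hjd]; exact e
    · exact hx j (mem_erase.2 ⟨hjd, hj⟩), hx₁, hx₂⟩
  set x' := Function.update x q (!x q) with hx'
  refine hT3 ⟨x', fun j hj => ?_, ?_, ?_⟩
  · by_cases hjd : j = d
    · subst hjd
      rw [eval_eq hI hpq] at hdx ⊢
      rw [hx', Function.update_self, Function.update_of_ne (hv 0 (by decide)), Function.update_of_ne (hv 1 (by decide)),
        Function.update_of_ne hpq', hp]
      rw [hp] at hdx
      revert hdx
      cases x (I.vars j 0) <;> cases x (I.vars j 1) <;> cases x q <;> cases y j <;> decide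
    · rw [hx', eval_update_of_not_mem I j x (hqK j (mem_of_mem_erase (mem_erase.2 ⟨hjd, hj⟩)) hjd)]
      exact hx j (mem_erase.2 ⟨hjd, hj⟩)
  · rw [hx', gval_update_of_forall_ne I x hqC.1 fun g hg => hqG g (mem_union_left _ hg)]; exact hx₁
  · rw [hx', gval_update_of_forall_ne I x hqC.2 fun g hg => hqG g (mem_union_right _ hg)]; exact hx₂

end Private

/-! ## The pure connector: one gate `h = (s, p) ∈ G₂ ∖ G₁`, `q` untouched, `p, q` unread -/
section Connector

/-- The modified reader `Γ₂[h ↦ s]`: the gate replaced by its literal. -/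
theorem bit_gval_lift (hh : h ∈ w₂.2.1) (hslots : (I.vars h 2 = s ∧ I.vars h 3 = p) ∨ (I.vars h 2 = p ∧ I.vars h 3 = s))
    {x : Fin n → Bool} (hp : x p = true) :
    bit (gval I (w₂.1 ∆ {s}) (w₂.2.1.erase h) x) = bit (gval I w₂.1 w₂.2.1 x) := by
  classical
  rw [bit_gval, bit_gval, sum_symmDiff_zmod2, sum_singleton, ← add_sum_erase _ _ hh]
  have hmono : bit (x (I.vars h 2)) * bit (x (I.vars h 3)) = bit (x s) := by
    rcases hslots with ⟨h2, h3⟩ | ⟨h2, h3⟩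
    · rw [h2, h3, hp]; simp [bit]
    · rw [h2, h3, hp]; simp [bit]
  rw [hmono]
  ring

/-- With the gate off (`x_p = 0`) the modified reader exceeds `Γ₂` by the literal `x_s`. -/
theorem bit_gval_lift_off (hh : h ∈ w₂.2.1) (hslots : (I.vars h 2 = s ∧ I.vars h 3 = p) ∨ (I.vars h 2 = p ∧ I.vars h 3 = s))
    {x : Fin n → Bool} (hp : x p = false) :
    bit (gval I (w₂.1 ∆ {s}) (w₂.2.1.erase h) x) = bit (gval I w₂.1 w₂.2.1 x) + bit (x s) := by
  classical
  rw [bit_gval, bit_gval, sum_symmDiff_zmod2, sum_singleton, ← add_sum_erase _ _ hh]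
  have hmono : bit (x (I.vars h 2)) * bit (x (I.vars h 3)) = 0 := by
    rcases hslots with ⟨h2, h3⟩ | ⟨h2, h3⟩
    · rw [h2, h3, hp]; simp [bit]
    · rw [h2, h3, hp]; simp [bit]
  rw [hmono]
  ring

/-- The modified reader does not read `p, q`. -/
theorem gval_lift_set_pair (hI : I.IsPure xorAndPred) (hh : h ∈ w₂.2.1)
    (hslots : (I.vars h 2 = s ∧ I.vars h 3 = p) ∨ (I.vars h 2 = p ∧ I.vars h 3 = s))
    (hpC : p ∉ w₂.1) (hqC : q ∉ w₂.1) (hpG : ∀ g ∈ w₂.2.1, g ≠ h → I.vars g 2 ≠ p ∧ I.vars g 3 ≠ p)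
    (hqG : ∀ g ∈ w₂.2.1, I.vars g 2 ≠ q ∧ I.vars g 3 ≠ q) (x : Fin n → Bool) (a c : Bool) :
    gval I (w₂.1 ∆ {s}) (w₂.2.1.erase h) (Function.update (Function.update x p a) q c) = gval I (w₂.1 ∆ {s}) (w₂.2.1.erase h) x := by
  classical
  have hsp : s ≠ p := ne_of_slots hI hslots
  have hsq : s ≠ q := by
    rcases hslots with ⟨h2, -⟩ | ⟨-, h3⟩
    · rw [← h2]; exact (hqG h hh).1
    · rw [← h3]; exact (hqG h hh).2
  have hpC' : p ∉ w₂.1 ∆ {s} := by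
    rw [mem_symmDiff, mem_singleton]; push Not
    exact ⟨fun hp => absurd hp hpC, fun hp => absurd hp hsp.symm⟩
  have hqC' : q ∉ w₂.1 ∆ {s} := by
    rw [mem_symmDiff, mem_singleton]; push Not
    exact ⟨fun hq => absurd hq hqC, fun hq => absurd hq hsq.symm⟩
  exact gval_set_pair hpC' hqC' (fun g hg => hpG g (mem_of_mem_erase hg) (ne_of_mem_erase hg))
    (fun g hg => hqG g (mem_of_mem_erase hg)) x a c

/-- **THE GATE IS ARMED AND OFF AT THE WITNESS.**  For a pure connector (`q` untouched; `p` touched only by `h = (s, p) ∉ G₁`; `p, q` unread)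
every (M0) witness of `d` has `x_p = 0` and `x_s = 1`: with `x_s = 0` the pair `(p, q)` could be reset to satisfy `d` without moving `Γ₂`
(`h ∈ G₂` is not even needed: with `h` in no reader the member would be naked). -/
theorem gate_witness (hI : I.IsPure xorAndPred) (hT : Typed I) (ht : Terminal I r y K w₁ w₂)
    (hpq : (I.vars d 2 = p ∧ I.vars d 3 = q) ∨ (I.vars d 2 = q ∧ I.vars d 3 = p))
    (hpK : ∀ j ∈ K, j ≠ d → p ∉ varSet I j) (hqK : ∀ j ∈ K, j ≠ d → q ∉ varSet I j)
    (hh₁ : h ∉ w₁.2.1) (hslots : (I.vars h 2 = s ∧ I.vars h 3 = p) ∨ (I.vars h 2 = p ∧ I.vars h 3 = s))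
    (hpC : p ∉ w₁.1 ∧ p ∉ w₂.1) (hqC : q ∉ w₁.1 ∧ q ∉ w₂.1) (hpG : ∀ g ∈ w₁.2.1 ∪ w₂.2.1, g ≠ h → I.vars g 2 ≠ p ∧ I.vars g 3 ≠ p)
    (hqG : ∀ g ∈ w₁.2.1 ∪ w₂.2.1, I.vars g 2 ≠ q ∧ I.vars g 3 ≠ q)
    {x : Fin n → Bool} (hx : ∀ j ∈ K.erase d, I.eval x j = y j) (hx₁ : gval I w₁.1 w₁.2.1 x = w₁.2.2) (hx₂ : gval I w₂.1 w₂.2.1 x = w₂.2.2) :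
    x p = false ∧ x s = true := by
  classical
  have hp0 := partner_false_at_witness hI hT ht hpq hqK hqC hqG hx hx₁ hx₂
  refine ⟨hp0, ?_⟩
  obtain ⟨-, -, -, -, -, -, hT3, -⟩ := ht
  by_contra hs
  rw [Bool.not_eq_true] at hs
  -- reset `(p, q) := (1, c)` to satisfy `d`; `Γ₂` moves by `x_s·(1 ⊕ x_p) = 0`
  set c := xor (xor (x (I.vars d 0)) (x (I.vars d 1))) (y d) with hc
  obtain ⟨hK', hdval⟩ := solves_set_pair (K := K) (y := y) hI hT hpq hpK hqK hx true c
  have hpG₁ : ∀ g ∈ w₁.2.1, I.vars g 2 ≠ p ∧ I.vars g 3 ≠ p := fun g hg =>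
    hpG g (mem_union_left _ hg) fun e => hh₁ (e ▸ hg)
  refine hT3 ⟨Function.update (Function.update x p true) q c, fun j hj => ?_, ?_, ?_⟩
  · by_cases hjd : j = d
    · subst hjd; rw [hdval, Bool.true_and, hc]
      cases x (I.vars j 0) <;> cases x (I.vars j 1) <;> cases y j <;> decide
    · exact hK' j (mem_erase.2 ⟨hjd, hj⟩)
  · rw [gval_set_pair hpC.1 hqC.1 hpG₁ (fun g hg => hqG g (mem_union_left _ hg))]; exact hx₁
  · -- `Γ₂` at the reset point: first `q`, harmless; then `p : 0 ↦ 1` moves by `x_s = 0`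
    rw [gval_update_of_forall_ne I _ hqC.2 fun g hg => hqG g (mem_union_right _ hg)]
    have hflip := gval_flip_halfFree I hI w₂.1 w₂.2.1 (g := h) (σ := s) (π := p) hslots
      (fun g hg hne => hpG g (mem_union_right _ hg) hne) x
    rw [hp0, Bool.not_false] at hflip
    rw [hflip, hx₂, hs, decide_eq_false hpC.2]
    simp

/-- **(T3) TRANSFERS TO `K ∖ d` WITH THE GATE LIFTED.**  For a pure connector, on `Sol(K ∖ d) ∩ {Γ₁ = b₁}` the modified reader
`Γ₂' = (C₂ ∆ {s}, G₂ ∖ h, b₂) = Γ₂[x_p := 1]` misses `b₂` (reset `(p, q)` to `(1, c)` satisfying `d`; (T3) there; `Γ₂` at the reset point is `Γ₂'`). -/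
theorem transfer (hI : I.IsPure xorAndPred) (hT : Typed I) (ht : Terminal I r y K w₁ w₂)
    (hpq : (I.vars d 2 = p ∧ I.vars d 3 = q) ∨ (I.vars d 2 = q ∧ I.vars d 3 = p))
    (hpK : ∀ j ∈ K, j ≠ d → p ∉ varSet I j) (hqK : ∀ j ∈ K, j ≠ d → q ∉ varSet I j)
    (hh : h ∈ w₂.2.1) (hh₁ : h ∉ w₁.2.1) (hslots : (I.vars h 2 = s ∧ I.vars h 3 = p) ∨ (I.vars h 2 = p ∧ I.vars h 3 = s))
    (hpC : p ∉ w₁.1 ∧ p ∉ w₂.1) (hqC : q ∉ w₁.1 ∧ q ∉ w₂.1) (hpG : ∀ g ∈ w₁.2.1 ∪ w₂.2.1, g ≠ h → I.vars g 2 ≠ p ∧ I.vars g 3 ≠ p)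
    (hqG : ∀ g ∈ w₁.2.1 ∪ w₂.2.1, I.vars g 2 ≠ q ∧ I.vars g 3 ≠ q)
    {x : Fin n → Bool} (hx : ∀ j ∈ K.erase d, I.eval x j = y j) (hx₁ : gval I w₁.1 w₁.2.1 x = w₁.2.2) :
    gval I (w₂.1 ∆ {s}) (w₂.2.1.erase h) x ≠ w₂.2.2 := by
  classical
  obtain ⟨-, -, -, -, -, -, hT3, -⟩ := ht
  intro hx₂'
  set c := xor (xor (x (I.vars d 0)) (x (I.vars d 1))) (y d) with hc
  obtain ⟨hK', hdval⟩ := solves_set_pair (K := K) (y := y) hI hT hpq hpK hqK hx true c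
  set x' := Function.update (Function.update x p true) q c with hx'
  have hpG₁ : ∀ g ∈ w₁.2.1, I.vars g 2 ≠ p ∧ I.vars g 3 ≠ p := fun g hg =>
    hpG g (mem_union_left _ hg) fun e => hh₁ (e ▸ hg)
  have hpq' : p ≠ q := ne_of_slots hI hpq
  have hx'p : x' p = true := by rw [hx', Function.update_of_ne hpq', Function.update_self]
  refine hT3 ⟨x', fun j hj => ?_, ?_, ?_⟩
  · by_cases hjd : j = d
    · subst hjd; rw [hdval, Bool.true_and, hc]
      cases x (I.vars j 0) <;> cases x (I.vars j 1) <;> cases y j <;> decide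
    · exact hK' j (mem_erase.2 ⟨hjd, hj⟩)
  · rw [hx', gval_set_pair hpC.1 hqC.1 hpG₁ (fun g hg => hqG g (mem_union_left _ hg))]; exact hx₁
  · apply bit_injective
    rw [← bit_gval_lift hh hslots hx'p, hx', gval_lift_set_pair hI hh hslots hpC.2 hqC.2
      (fun g hg hne => hpG g (mem_union_right _ hg) hne) (fun g hg => hqG g (mem_union_right _ hg)), hx₂']

/-- **Where the XOR part of `d` is on target, the literal is OFF.**  On `Sol(K ∖ d) ∩ {Γ₁ = b₁} ∩ {x_{v₀} ⊕ x_{v₁} = y_d}`: `x_s = 0`, and the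
gate-less reader `(C₂, G₂ ∖ h)` misses `b₂` there (reset `(p, q) := (0, 0)`: `d` holds, `Γ₂` becomes gate-less; compare with `transfer`). -/
theorem literal_false_of_xor (hI : I.IsPure xorAndPred) (hT : Typed I) (ht : Terminal I r y K w₁ w₂)
    (hpq : (I.vars d 2 = p ∧ I.vars d 3 = q) ∨ (I.vars d 2 = q ∧ I.vars d 3 = p))
    (hpK : ∀ j ∈ K, j ≠ d → p ∉ varSet I j) (hqK : ∀ j ∈ K, j ≠ d → q ∉ varSet I j)
    (hh : h ∈ w₂.2.1) (hh₁ : h ∉ w₁.2.1) (hslots : (I.vars h 2 = s ∧ I.vars h 3 = p) ∨ (I.vars h 2 = p ∧ I.vars h 3 = s))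
    (hpC : p ∉ w₁.1 ∧ p ∉ w₂.1) (hqC : q ∉ w₁.1 ∧ q ∉ w₂.1) (hpG : ∀ g ∈ w₁.2.1 ∪ w₂.2.1, g ≠ h → I.vars g 2 ≠ p ∧ I.vars g 3 ≠ p)
    (hqG : ∀ g ∈ w₁.2.1 ∪ w₂.2.1, I.vars g 2 ≠ q ∧ I.vars g 3 ≠ q)
    {x : Fin n → Bool} (hx : ∀ j ∈ K.erase d, I.eval x j = y j) (hx₁ : gval I w₁.1 w₁.2.1 x = w₁.2.2)
    (hxor : xor (x (I.vars d 0)) (x (I.vars d 1)) = y d) : x s = false := by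
  classical
  have hT3 := ht.2.2.2.2.2.2.1
  have htr := transfer hI hT ht hpq hpK hqK hh hh₁ hslots hpC hqC hpG hqG hx hx₁
  obtain ⟨hK', hdval⟩ := solves_set_pair (K := K) (y := y) hI hT hpq hpK hqK hx false false
  set x' := Function.update (Function.update x p false) q false with hx'
  have hpG₁ : ∀ g ∈ w₁.2.1, I.vars g 2 ≠ p ∧ I.vars g 3 ≠ p := fun g hg =>
    hpG g (mem_union_left _ hg) fun e => hh₁ (e ▸ hg)
  have hpq' : p ≠ q := ne_of_slots hI hpq
  have hx'p : x' p = false := by rw [hx', Function.update_of_ne hpq', Function.update_self]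
  -- the reset point solves `K` and keeps `Γ₁`, so `Γ₂` misses there
  have h₂ : gval I w₂.1 w₂.2.1 x' ≠ w₂.2.2 := fun e => hT3 ⟨x', fun j hj => by
      by_cases hjd : j = d
      · subst hjd; rw [hdval, Bool.false_and, Bool.xor_false]; exact hxor
      · exact hK' j (mem_erase.2 ⟨hjd, hj⟩),
    by rw [hx', gval_set_pair hpC.1 hqC.1 hpG₁ (fun g hg => hqG g (mem_union_left _ hg))]; exact hx₁, e⟩
  -- and the lifted reader misses at `x`, i.e. at `x'`
  have h₂' : gval I (w₂.1 ∆ {s}) (w₂.2.1.erase h) x' ≠ w₂.2.2 := by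
    rw [hx', gval_lift_set_pair hI hh hslots hpC.2 hqC.2 (fun g hg hne => hpG g (mem_union_right _ hg) hne)
      (fun g hg => hqG g (mem_union_right _ hg))]
    exact htr
  have key := bit_gval_lift_off hh hslots hx'p
  have hsx : x' s = x s := by
    have hsp : s ≠ p := ne_of_slots hI hslots
    have hsq : s ≠ q := by
      rcases hslots with ⟨h2, -⟩ | ⟨-, h3⟩
      · rw [← h2]; exact (hqG h (mem_union_right _ hh)).1
      · rw [← h3]; exact (hqG h (mem_union_right _ hh)).2
    rw [hx', Function.update_of_ne hsq, Function.update_of_ne hsp]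
  rw [← hsx]
  revert h₂ h₂' key
  cases gval I w₂.1 w₂.2.1 x' <;> cases gval I (w₂.1 ∆ {s}) (w₂.2.1.erase h) x' <;> cases w₂.2.2 <;> cases x' s <;> simp [bit]

end Connector

/-! ## The minimal-core reduction -/
section Core

/-- **A PURE CONNECTOR PLANTS A MINIMAL CORE IN `K ∖ d`.**  If the lifted pair `Γ₁ ∧ Γ₂'` is satisfiable at all, then some `M ⊆ K ∖ d` is a
`TerminalNC` core for `(Γ₁, Γ₂')` ((T3) + (M0), inside the radius). -/
theorem exists_core (hI : I.IsPure xorAndPred) (hT : Typed I) (ht : Terminal I r y K w₁ w₂)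
    (hpq : (I.vars d 2 = p ∧ I.vars d 3 = q) ∨ (I.vars d 2 = q ∧ I.vars d 3 = p))
    (hpK : ∀ j ∈ K, j ≠ d → p ∉ varSet I j) (hqK : ∀ j ∈ K, j ≠ d → q ∉ varSet I j)
    (hh : h ∈ w₂.2.1) (hh₁ : h ∉ w₁.2.1) (hslots : (I.vars h 2 = s ∧ I.vars h 3 = p) ∨ (I.vars h 2 = p ∧ I.vars h 3 = s))
    (hpC : p ∉ w₁.1 ∧ p ∉ w₂.1) (hqC : q ∉ w₁.1 ∧ q ∉ w₂.1) (hpG : ∀ g ∈ w₁.2.1 ∪ w₂.2.1, g ≠ h → I.vars g 2 ≠ p ∧ I.vars g 3 ≠ p)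
    (hqG : ∀ g ∈ w₁.2.1 ∪ w₂.2.1, I.vars g 2 ≠ q ∧ I.vars g 3 ≠ q)
    (hfeas : ∃ z : Fin n → Bool, gval I w₁.1 w₁.2.1 z = w₁.2.2 ∧ gval I (w₂.1 ∆ {s}) (w₂.2.1.erase h) z = w₂.2.2) :
    ∃ M ⊆ K.erase d, TerminalNC I r y M w₁ (w₂.1 ∆ {s}, w₂.2.1.erase h, w₂.2.2) := by
  classical
  obtain ⟨hKr, hd₁, hd₂, hr⟩ : K.card < r ∧ Disjoint K w₁.2.1 ∧ Disjoint K w₂.2.1 ∧ (K ∪ w₁.2.1 ∪ w₂.2.1).card ≤ r :=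
    ⟨ht.2.2.1, ht.2.2.2.1, ht.2.2.2.2.1, ht.2.2.2.2.2.1⟩
  have hns : ¬ SatPair I y (K.erase d) w₁ (w₂.1 ∆ {s}, w₂.2.1.erase h, w₂.2.2) := by
    rintro ⟨x, hx, hx₁, hx₂⟩
    exact transfer hI hT ht hpq hpK hqK hh hh₁ hslots hpC hqC hpG hqG hx hx₁ hx₂
  obtain ⟨M, hMK, hM, hmin⟩ := exists_minimal_core I y hns
  refine ⟨M, hMK, ?_, ?_, hd₁.mono_left (hMK.trans (erase_subset d K)), ?_, ?_, hM, hmin⟩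
  · rw [nonempty_iff_ne_empty]
    rintro rfl
    obtain ⟨z, hz₁, hz₂⟩ := hfeas
    exact hM ⟨z, fun j hj => absurd hj (notMem_empty j), hz₁, hz₂⟩
  · exact lt_of_le_of_lt (card_le_card (hMK.trans (erase_subset d K))) hKr
  · exact (hd₂.mono_left (hMK.trans (erase_subset d K))).mono_right (erase_subset h _)
  · refine le_trans (card_le_card ?_) hr
    exact union_subset_union (union_subset_union (hMK.trans (erase_subset d K)) (Subset.refl _)) (erase_subset h _)

/-- **Inside the core-bound induction the planted core is small**: the XOR core of `M` has at most five members (it is empty, or a terminal core for a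
peeled pair by `PstarTipsChain.core_terminal`, and a proper terminal sub-core of `K`). -/
theorem card_xcore_core_le_five (hI : I.IsPure xorAndPred) (hT : Typed I) {M : Finset (Fin m)} (hMK : M ⊆ K.erase d)
    {w₂' : Finset (Fin n) × Finset (Fin m) × Bool} (hM : TerminalNC I r y M w₁ w₂')
    (hIH : ∀ K₀ ⊆ K.erase d, ∀ d₁ d₂ : Finset (Fin n) × Finset (Fin m) × Bool, Terminal I r y K₀ d₁ d₂ → K₀.card ≤ 5) :
    (xcore I M).card ≤ 5 := by
  classical
  rcases core_terminal I hI hT y M (w₁.2.1 ∪ w₂'.2.1) M.card M w₁ w₂' le_rfl (Subset.refl M) hM subset_union_left with h0 | ⟨A', w', ht', -⟩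
  · rw [h0, card_empty]; omega
  · exact hIH _ ((xcore_subset I M).trans hMK) A' w' ht'

/-- **OUTSIDE THE PLANTED CORE THE LITERAL IS PINNED.**  Every member `f` of `K` off `M ∪ {d}` has ALL its (M0) witnesses (for the original pair)
with the gate armed and off: `x_s = 1`, `x_p = 0` (the witness solves `M` and `Γ₁`, so the lifted reader misses; it differs from `Γ₂ = b₂` by
`x_s·(1 ⊕ x_p)`). -/
theorem witness_outside_core (hh : h ∈ w₂.2.1) (hslots : (I.vars h 2 = s ∧ I.vars h 3 = p) ∨ (I.vars h 2 = p ∧ I.vars h 3 = s))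
    {M : Finset (Fin m)} (hMK : M ⊆ K.erase d) (hM : ¬ SatPair I y M w₁ (w₂.1 ∆ {s}, w₂.2.1.erase h, w₂.2.2))
    {f : Fin m} (hfM : f ∉ M) {x : Fin n → Bool} (hx : ∀ j ∈ K.erase f, I.eval x j = y j) (hx₁ : gval I w₁.1 w₁.2.1 x = w₁.2.2)
    (hx₂ : gval I w₂.1 w₂.2.1 x = w₂.2.2) : x s = true ∧ x p = false := by
  have hxM : ∀ j ∈ M, I.eval x j = y j := fun j hj =>
    hx j (mem_erase.2 ⟨fun e => hfM (e ▸ hj), mem_of_mem_erase (hMK hj)⟩)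
  have hmiss : gval I (w₂.1 ∆ {s}) (w₂.2.1.erase h) x ≠ w₂.2.2 := fun e => hM ⟨x, hxM, hx₁, e⟩
  by_cases hp : x p = true
  · exact absurd (by rw [← bit_injective (bit_gval_lift hh hslots hp)] at hx₂; exact hx₂) hmiss
  · rw [Bool.not_eq_true] at hp
    refine ⟨?_, hp⟩
    have key := bit_gval_lift_off hh hslots hp
    revert hmiss key
    rw [hx₂]
    cases gval I (w₂.1 ∆ {s}) (w₂.2.1.erase h) x <;> cases w₂.2.2 <;> cases x s <;> simp [bit]

end Core

end Summit.PneNP.PneNP.Theorems.PstarPureConnector
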